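import Mathlib.Analysis.Calculus.Deriv.MeanValue
import Mathlib.Analysis.SpecialFunctions.Integrals.Basic
import HarnessLib

/-!
# The mean value form of a function and of a quadrature cell

Topic `Literature/Analysis/ValidatedNumerics`. Moore's **mean value form** (Moore, *Methods and
Applications of Interval Analysis* (1979), §4.4 (4.19)): if `f` is continuous on `[a,b]`,
differentiable inside, and an enclosure `f' ∈ [dlo, dhi]` of the derivative on the cell is known, then
with the centre `c = (dhi+dlo)/2` and radius `r = (dhi-dlo)/2` of the derivative enclosure,

* `abs_sub_sub_mul_le_of_deriv_mem` — `|f v - f m - c (v - m)| ≤ r |v - m|` for all `v, m ∈ [a,b]`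
  (the mean value form centred at `m`, with the slope enclosure recentred);
* `integral_abs_sub_midpoint` — `∫_a^b |x - (a+b)/2| dx = (b-a)²/4`;
* `abs_integral_sub_midpoint_le_of_deriv_mem` — **the mean-value-form enclosure of a quadrature
  cell**: `|∫_a^b f - (b-a)·f((a+b)/2)| ≤ (dhi - dlo)(b-a)²/8` (integrate the first item at the
  midpoint; the centred linear term integrates to zero). This is the acceptance rule
  "`∫_cell f ∈ w·f(mid) + [-1,1]·(d⁺-d⁻)w²/8`" of first-order (dual-number) certified quadratures;
  compare the second-order midpoint bound `abs_integral_sub_midpoint_le`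
  (`Quadrature/MidpointTrapezoidPeanoKernel.lean`, needs `f''`).

Hypotheses follow Mathlib's mean value inequalities (`Convex.mul_sub_le_image_sub_of_le_deriv`,
`Convex.image_sub_le_mul_sub_of_deriv_le`): `ContinuousOn f (Icc a b)`, `DifferentiableOn ℝ f (Ioo a b)`,
bounds on `deriv f` on `Ioo a b`.

## References
* [Moore1979] R. E. Moore, *Methods and Applications of Interval Analysis*, SIAM (1979), §4.4, (4.19)
  (mean value form).
-/

noncomputable section

open MeasureTheory Set intervalIntegral

namespace Literature.Analysis.ValidatedNumerics

/-- **Mean value form, recentred** (Moore (4.19) in one variable): if `dlo ≤ f' ≤ dhi` on `(a,b)`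
then for `v, m ∈ [a,b]`, `|f v - f m - ((dhi+dlo)/2)(v - m)| ≤ ((dhi-dlo)/2)|v - m|`.
[cite: Moore1979, §4.4 (4.19)] -/
theorem abs_sub_sub_mul_le_of_deriv_mem {f : ℝ → ℝ} {a b dlo dhi : ℝ}
    (hcont : ContinuousOn f (Icc a b)) (hdiff : DifferentiableOn ℝ f (Ioo a b))
    (hlo : ∀ x ∈ Ioo a b, dlo ≤ deriv f x) (hhi : ∀ x ∈ Ioo a b, deriv f x ≤ dhi)
    {v m : ℝ} (hv : v ∈ Icc a b) (hm : m ∈ Icc a b) :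
    |f v - f m - (dhi + dlo) / 2 * (v - m)| ≤ (dhi - dlo) / 2 * |v - m| := by
  have hdiff' : DifferentiableOn ℝ f (interior (Icc a b)) := by rwa [interior_Icc]
  have hlo' : ∀ x ∈ interior (Icc a b), dlo ≤ deriv f x := by rwa [interior_Icc]
  have hhi' : ∀ x ∈ interior (Icc a b), deriv f x ≤ dhi := by rwa [interior_Icc]
  have low := (convex_Icc a b).mul_sub_le_image_sub_of_le_deriv hcont hdiff' hlo'
  have upp := (convex_Icc a b).image_sub_le_mul_sub_of_deriv_le hcont hdiff' hhi'
  rcases le_total m v with hmv | hvm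
  · have h1 := low m hm v hv hmv
    have h2 := upp m hm v hv hmv
    rw [abs_of_nonneg (sub_nonneg.2 hmv), abs_le]
    constructor <;> nlinarith
  · have h1 := low v hv m hm hvm
    have h2 := upp v hv m hm hvm
    rw [abs_of_nonpos (sub_nonpos.2 hvm), abs_le]
    constructor <;> nlinarith

/-- **`∫_a^b |x - (a+b)/2| dx = (b-a)²/4`** (`a ≤ b`). [cite: Moore1979, §4.4 (4.19)] -/
theorem integral_abs_sub_midpoint {a b : ℝ} (hab : a ≤ b) :
    ∫ x in a..b, |x - (a + b) / 2| = (b - a) ^ 2 / 4 := by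
  set m := (a + b) / 2 with hm
  have ham : a ≤ m := by rw [hm]; linarith
  have hmb : m ≤ b := by rw [hm]; linarith
  have hint : ∀ c d : ℝ, IntervalIntegrable (fun x : ℝ => |x - m|) volume c d := fun c d =>
    (continuous_abs.comp (continuous_id.sub continuous_const)).intervalIntegrable c d
  rw [← integral_add_adjacent_intervals (hint a m) (hint m b)]
  have h1 : ∫ x in a..m, |x - m| = ∫ x in a..m, (m - x) := by
    refine integral_congr fun x hx => ?_
    rw [uIcc_of_le ham] at hx
    rw [abs_of_nonpos (by linarith [hx.2])]; ring
  have h2 : ∫ x in m..b, |x - m| = ∫ x in m..b, (x - m) := by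
    refine integral_congr fun x hx => ?_
    rw [uIcc_of_le hmb] at hx
    rw [abs_of_nonneg (by linarith [hx.1])]
  rw [h1, h2, integral_sub intervalIntegrable_const intervalIntegral.intervalIntegrable_id,
    intervalIntegral.integral_sub intervalIntegral.intervalIntegrable_id intervalIntegrable_const,
    intervalIntegral.integral_const, intervalIntegral.integral_const, integral_id, integral_id]
  simp only [smul_eq_mul, hm]
  ring

/-- **Mean-value-form enclosure of a quadrature cell**: if `f` is continuous on `[a,b]` (`a ≤ b`),
differentiable on `(a,b)` with `dlo ≤ f' ≤ dhi` there, then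
`|∫_a^b f - (b-a) f((a+b)/2)| ≤ (dhi - dlo)(b-a)²/8`. [cite: Moore1979, §4.4 (4.19)] -/
theorem abs_integral_sub_midpoint_le_of_deriv_mem {f : ℝ → ℝ} {a b dlo dhi : ℝ} (hab : a ≤ b)
    (hcont : ContinuousOn f (Icc a b)) (hdiff : DifferentiableOn ℝ f (Ioo a b))
    (hlo : ∀ x ∈ Ioo a b, dlo ≤ deriv f x) (hhi : ∀ x ∈ Ioo a b, deriv f x ≤ dhi) :
    |(∫ x in a..b, f x) - (b - a) * f ((a + b) / 2)| ≤ (dhi - dlo) * (b - a) ^ 2 / 8 := by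
  set m := (a + b) / 2 with hm
  set c := (dhi + dlo) / 2 with hc
  set r := (dhi - dlo) / 2 with hr
  have hmmem : m ∈ Icc a b := ⟨by rw [hm]; linarith, by rw [hm]; linarith⟩
  have hfi : IntervalIntegrable f volume a b := hcont.intervalIntegrable_of_Icc hab
  -- pointwise mean value form
  have hpt : ∀ x ∈ Icc a b, |f x - f m - c * (x - m)| ≤ r * |x - m| := fun x hx =>
    abs_sub_sub_mul_le_of_deriv_mem hcont hdiff hlo hhi hx hmmem
  -- integrability of the pieces
  have hgi : IntervalIntegrable (fun x => f x - f m - c * (x - m)) volume a b :=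
    (hfi.sub intervalIntegrable_const).sub
      ((intervalIntegral.intervalIntegrable_id.sub intervalIntegrable_const).const_mul c)
  have hri : IntervalIntegrable (fun x => r * |x - m|) volume a b :=
    ((continuous_abs.comp (continuous_id.sub continuous_const)).intervalIntegrable a b).const_mul r
  -- the centred linear term integrates to zero
  have hlin : ∫ x in a..b, c * (x - m) = 0 := by
    rw [intervalIntegral.integral_const_mul,
      intervalIntegral.integral_sub intervalIntegral.intervalIntegrable_id intervalIntegrable_const,
      integral_id, intervalIntegral.integral_const, smul_eq_mul, hm]
    ring
  -- rewrite the error as the integral of the centred remainder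
  have hsplit : (∫ x in a..b, f x) - (b - a) * f m = ∫ x in a..b, (f x - f m - c * (x - m)) := by
    rw [intervalIntegral.integral_sub (hfi.sub intervalIntegrable_const)
        ((intervalIntegral.intervalIntegrable_id.sub intervalIntegrable_const).const_mul c),
      intervalIntegral.integral_sub hfi intervalIntegrable_const, intervalIntegral.integral_const,
      hlin, smul_eq_mul]
    ring
  rw [hsplit]
  calc |∫ x in a..b, (f x - f m - c * (x - m))|
      ≤ ∫ x in a..b, |f x - f m - c * (x - m)| :=
        intervalIntegral.abs_integral_le_integral_abs hab
    _ ≤ ∫ x in a..b, r * |x - m| :=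
        intervalIntegral.integral_mono_on hab hgi.abs hri fun x hx => hpt x hx
    _ = r * ((b - a) ^ 2 / 4) := by
        rw [intervalIntegral.integral_const_mul, hm, integral_abs_sub_midpoint hab]
    _ = (dhi - dlo) * (b - a) ^ 2 / 8 := by rw [hr]; ring

end Literature.Analysis.ValidatedNumerics

end
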